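import Summits.CriticalPhenomena.PercolationContinuityZ3.Theorems.SahiMasterFamilyPrincipalCapDichotomy
import Summits.CriticalPhenomena.PercolationContinuityZ3.Theorems.SahiMasterFamilyPCDCoatom
import Summits.CriticalPhenomena.PercolationContinuityZ3.Theorems.SahiMasterFamilyPCDCylinders

/-!
# The principal-cap dichotomy, IV: THE KEY STEP at every order — `KeyStep n` and `PCD n` for all `n`

Support file of the master-family programme (crux `NoHeavyLowerTail`, stmt-CriticalPhenomena-4575; cell `prim-masterthm`, seat P4,
unit `prim-masterthm-p4-g6`).  Seat document HOME/prim-masterthm-p4/PROOF-PCD.md §2–§4.  Completes `SahiMasterFamilyPrincipalCapDichotomy`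
(typed conjecture `PCD n`, key lemma `KeyStep n`, reduction `pcd_of_keyStep`) with `SahiMasterFamilyPCD{Abstract, Coatom, Cylinders}`.

Let `U_0,…,U_{n+1}` be increasing events (up-closed, `∅ ∉ U_i`), principal-cap at `c` (`⋂ U_i = ↑c`), with `Λ(U) = N_Q(𝟙) = 0` for the
union-closed family `Q = goodBlocks` of the traces `F_i = {a ∈ U_i : a ⊆ c}` (point cores `κ_j`).
* CASE A — every singleton block is good.  Then every co-point is good (union of singletons), the point cores are pairwise disjoint with
  `c ∖ κ_j ∈ F_l` (`l ≠ j`) (`core_erase_of_good`), so every event is the CYLINDER `U_j = {ω ⊇ κ_j}` (`eq_cyl_of_principal`, global cores)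
  and `E_{n+2} ≡ 0` by `sahiE_spw_cyl_eq_zero`: `sahiE_eq_zero_of_forall_singleton_good`.
* CASE B — some singleton `{i}` is not good.  COATOM LEMMA ⇒ all co-points good ⇒ cores pairwise disjoint, `c' := c ∖ κ_i ∈ U_l` (`l ≠ i`);
  RESTRICTION LEMMA ⇒ `N_{Q|M} = 0` (`M = [n+2] ∖ i`; forces `n ≥ 1`); COATOM LEMMA on `Q|M` ⇒ co-2-sets good; CLAIM A: `U_{−i}` is
  principal-cap at `c'`; the point cores of its trace family `G` satisfy `κ^G_l ⊆ κ_l`, whence every member of `Q|M` pulls back to a good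
  block of `G`; ANTITONICITY + relabelling ⇒ `0 ≤ N_{goodBlocks G} ≤ N_{Q|M} = 0`, i.e. `Λ(U_{−i}) = 0`: `exists_principalCap_delete`.
* **`keyStep_holds : ∀ n, KeyStep n`** and **`pcd_holds : ∀ n, PCD n`** — THE PRINCIPAL-CAP DICHOTOMY AT EVERY ORDER: for a principal-cap
  family of increasing events, `E_k(spw w p; 1_U) ≡ 0` (all `w`, `p`) iff the finite permutation count `N_{Q(c)}(𝟙)` vanishes (the converse
  and `Λ > 0 ⇒ E > 0 near p = 0` are in `SahiMasterFamilyPrincipalCapDichotomy`).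
HONEST FRAMING: a theorem about the identically-zero locus of Sahi's `E_k` for increasing events under product weights; it says nothing
about positivity — Sahi `C_k` [Sahi2008, Conj. 5] / Kahn Conj. 5 / the master theorem remain OPEN.  [this work]
-/

namespace Summit.CriticalPhenomena.PercolationContinuityZ3.Theorems

namespace SahiSparseEnd

open Finset Function SahiRepresentativeForm
open Literature.Combinatorics.Sahi2008

universe u

/-! ### Trace families: cores cover `c`; good co-points -/

section Traces

variable {β : Type*} [DecidableEq β] {k : ℕ} {F : Fin k → Finset (Finset β)} {c : Finset β}
  (hup : ∀ i a a', a ∈ F i → a ⊆ a' → a' ⊆ c → a' ∈ F i)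
  (hcap : ∀ a : Finset β, a ⊆ c → ((∀ i, a ∈ F i) ↔ a = c))

include hup hcap in
/-- The point cores cover `c` (`k ≥ 1`). [this work] -/
theorem exists_mem_core (hk : 0 < k) {x : β} (hx : x ∈ c) : ∃ j, x ∈ core F c {j} := by
  have hxu : x ∈ core F c (univ : Finset (Fin k)) := by rw [core_univ hcap]; exact hx
  rw [core_eq_biUnion hup univ ⟨⟨0, hk⟩, mem_univ _⟩, mem_biUnion] at hxu
  obtain ⟨j, -, hj⟩ := hxu
  exact ⟨j, hj⟩

include hup hcap in
/-- **A good co-point** `[k] ∖ j`: its core is `c ∖ κ_j`, which therefore lies in `F_l` for every `l ≠ j`, and `κ_j` is disjoint from every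
other point core. [this work] -/
theorem core_erase_of_good {j : Fin k} (hj : univ.erase j ∈ goodBlocks F c) :
    core F c (univ.erase j) = c \ core F c {j} ∧ c \ core F c {j} ∈ FR F c (univ.erase j) ∧
      ∀ l, l ≠ j → Disjoint (core F c {l}) (core F c {j}) := by
  obtain ⟨hne, hmem, hdis⟩ := mem_goodBlocks.1 hj
  have hdis' : ∀ l, l ≠ j → Disjoint (core F c {l}) (core F c {j}) := fun l hl =>
    hdis l (mem_erase.2 ⟨hl, mem_univ l⟩) j (notMem_erase j univ)
  have hcore : core F c (univ.erase j) = c \ core F c {j} := by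
    have hd : Disjoint (core F c (univ.erase j)) (core F c {j}) := by
      rw [core_eq_biUnion hup _ hne, disjoint_biUnion_left]
      exact fun l hl => hdis' l (ne_of_mem_erase hl)
    refine subset_antisymm (fun x hx => mem_sdiff.2 ⟨core_subset hx, fun hxj => disjoint_left.1 hd hx hxj⟩) fun x hx => ?_
    obtain ⟨hxc, hxj⟩ := mem_sdiff.1 hx
    obtain ⟨l, hl⟩ := exists_mem_core hup hcap j.pos hxc
    have hlj : l ≠ j := fun e => hxj (e ▸ hl)
    exact core_mono (singleton_subset_iff.2 (mem_erase.2 ⟨hlj, mem_univ l⟩)) hl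
  exact ⟨hcore, hcore ▸ hmem, hdis'⟩

end Traces

/-! ### Principal-cap families: the trace hypotheses, global cores, cylinders -/

section Traces2

variable {ι : Type*} [DecidableEq ι] {m : ℕ} {V : Fin (m + 1) → Finset (Finset ι)} {c : Finset ι}

/-- The traces `F_i = {a ∈ V_i : a ⊆ c}` of up-closed events are up-closed inside `2^c`. [this work] -/
theorem Fc_upClosed (hV : ∀ i a a', a ∈ V i → a ⊆ a' → a' ∈ V i) :
    ∀ i a a', a ∈ Fc V c i → a ⊆ a' → a' ⊆ c → a' ∈ Fc V c i := by
  intro i a a' ha haa' ha'c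
  rw [Fc, mem_filter] at ha ⊢
  exact ⟨hV i a a' ha.1 haa', ha'c⟩

/-- For a principal-cap family, `⋂ F_i ∩ 2^c = {c}`. [this work] -/
theorem Fc_cap_of_principalCap (hpc : IsPrincipalCap V c) : ∀ a : Finset ι, a ⊆ c → ((∀ i, a ∈ Fc V c i) ↔ a = c) := by
  intro a hac
  constructor
  · intro hall
    exact subset_antisymm hac ((hpc a).1 fun i => (mem_filter.1 (hall i)).1)
  · rintro rfl
    exact fun i => mem_filter.2 ⟨(hpc _).2 subset_rfl i, subset_rfl⟩

/-- `∅ ∉ F_i` when `∅ ∉ V_i`. [this work] -/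
theorem Fc_empty_notMem (h0 : ∀ i, ∅ ∉ V i) : ∀ i, ∅ ∉ Fc V c i := fun i h => h0 i (mem_filter.1 h).1

end Traces2

section Events

variable {ι : Type*} [Fintype ι] [DecidableEq ι] {n : ℕ} {U : Fin (n + 2) → Finset (Finset ι)}
  (hU : ∀ i a a', a ∈ U i → a ⊆ a' → a' ∈ U i) (h0 : ∀ i, ∅ ∉ U i) {c : Finset ι} (hpc : IsPrincipalCap U c)

omit [Fintype ι] in
include hU hpc in
/-- **GLOBAL CORES.**  If `c ∖ κ_j` is a trace member of every other slot then every `ω ∈ U_j` contains `κ_j`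
(`ω ∪ (c ∖ κ_j) ∈ ⋂ U = ↑c`). [this work] -/
theorem core_subset_of_mem_event (j : Fin (n + 2)) (hcj : c \ core (Fc U c) c {j} ∈ FR (Fc U c) c (univ.erase j))
    {ω : Finset ι} (hω : ω ∈ U j) : core (Fc U c) c {j} ⊆ ω := by
  intro x hx
  have hall : ∀ l, ω ∪ (c \ core (Fc U c) c {j}) ∈ U l := by
    intro l
    by_cases hl : l = j
    · subst hl; exact hU _ _ _ hω subset_union_left
    · have h1 := (mem_FR.1 hcj).2 l (mem_erase.2 ⟨hl, mem_univ l⟩)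
      exact hU _ _ _ (mem_filter.1 h1).1 subset_union_right
  rcases mem_union.1 ((hpc _).1 hall (core_subset hx)) with h | h
  · exact h
  · exact absurd hx (mem_sdiff.1 h).2

include hU hpc in
/-- A slot with a PRINCIPAL trace (`κ_j ∈ F_j`) and `c ∖ κ_j` in every other trace is the cylinder `U_j = {ω : κ_j ⊆ ω}`. [this work] -/
theorem eq_cyl_of_principal (j : Fin (n + 2)) (hcj : c \ core (Fc U c) c {j} ∈ FR (Fc U c) c (univ.erase j))
    (hprin : core (Fc U c) c {j} ∈ Fc U c j) : U j = univ.filter fun ω => core (Fc U c) c {j} ⊆ ω := by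
  ext ω
  rw [mem_filter]
  constructor
  · intro hω; exact ⟨mem_univ _, core_subset_of_mem_event hU hpc j hcj hω⟩
  · rintro ⟨-, hω⟩; exact hU _ _ _ (mem_filter.1 hprin).1 hω

/-! ### Case A: every singleton block is good — a family of disjoint cylinders -/

include hU hpc in
/-- **CASE A.**  If every singleton block `{j}` is good then `E_{n+2}(spw w p; 1_U) = 0` for all `w`, `p`: all co-points are good, so
every `U_j` is the cylinder over `κ_j` and the `κ_j` are pairwise disjoint (`sahiE_spw_cyl_eq_zero`). [this work] -/
theorem sahiE_eq_zero_of_forall_singleton_good (hall : ∀ j, ({j} : Finset (Fin (n + 2))) ∈ goodBlocks (Fc U c) c)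
    (w : ι → ℝ) (p : ℝ) : sahiE (spw w p) (n + 2) (fun i => setInd (U i)) = 0 := by
  have hupF := Fc_upClosed hU (c := c)
  have hcapF := Fc_cap_of_principalCap hpc
  have hQ : ∀ A ∈ goodBlocks (Fc U c) c, ∀ B ∈ goodBlocks (Fc U c) c, A ∪ B ∈ goodBlocks (Fc U c) c :=
    fun A hA B hB => goodBlocks_union hupF hA hB
  -- every co-point is good: it is a nonempty union of singletons
  have herase : ∀ j : Fin (n + 2), univ.erase j ∈ goodBlocks (Fc U c) c := by
    intro j
    have hne : (univ.erase j : Finset (Fin (n + 2))).Nonempty := card_pos.1 (by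
      rw [card_erase_of_mem (mem_univ j), Finset.card_univ, Fintype.card_fin]; omega)
    have h := biUnion_mem_of_unionClosed hQ ((univ.erase j).image fun l => ({l} : Finset (Fin (n + 2))))
      (fun A hA => by obtain ⟨l, -, rfl⟩ := mem_image.1 hA; exact hall l) (hne.image _)
    have heq : ((univ.erase j).image fun l => ({l} : Finset (Fin (n + 2)))).biUnion id = univ.erase j := by
      ext l; simp
    rwa [heq] at h
  have hst := fun j => core_erase_of_good hupF hcapF (herase j)
  have hcyl : (fun i => setInd (U i)) = fun i => setInd (univ.filter fun ω => core (Fc U c) c {i} ⊆ ω) := by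
    funext j
    rw [eq_cyl_of_principal hU hpc j (hst j).2.1 ((mem_FR.1 (mem_goodBlocks.1 (hall j)).2.1).2 j (mem_singleton_self j))]
  rw [hcyl]
  exact sahiE_spw_cyl_eq_zero w p _ fun l j hlj => (hst j).2.2 l hlj

/-! ### Case B: a singleton block is not good — delete that slot -/

omit [Fintype ι] in
include hU h0 hpc in
/-- **CASE B (PROOF-PCD §3–§4).**  If `Λ(U) = 0` and the singleton block `{i}` is NOT good, then the deleted family `U_{−i}` is principal-cap
at `c ∖ κ_i` with `Λ(U_{−i}) = 0`. [this work] -/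
theorem exists_principalCap_delete (hΛ : LambdaSys (Fc U c) c = 0) (i : Fin (n + 2))
    (hi : ({i} : Finset (Fin (n + 2))) ∉ goodBlocks (Fc U c) c) :
    ∃ c' : Finset ι, IsPrincipalCap (fun j => U (i.succAbove j)) c' ∧ LambdaSys (Fc (fun j => U (i.succAbove j)) c') c' = 0 := by
  set F := Fc U c with hFdef
  set Q := goodBlocks F c with hQdef
  have hupF : ∀ i a a', a ∈ F i → a ⊆ a' → a' ⊆ c → a' ∈ F i := Fc_upClosed hU
  have hcapF : ∀ a : Finset ι, a ⊆ c → ((∀ i, a ∈ F i) ↔ a = c) := Fc_cap_of_principalCap hpc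
  have hneF : ∀ i, ∅ ∉ F i := Fc_empty_notMem h0
  have hk : 0 < n + 2 := by omega
  have hQu : ∀ A ∈ Q, ∀ B ∈ Q, A ∪ B ∈ Q := fun A hA B hB => goodBlocks_union hupF hA hB
  have hQX : Q ⊆ (univ : Finset (Fin (n + 2))).powerset := fun R _ => mem_powerset.2 (subset_univ R)
  have huQ : (univ : Finset (Fin (n + 2))) ∈ Q := univ_mem_goodBlocks hcapF hk
  have hZ : Z Q (fun _ => 1) univ = 0 := by
    have h := LambdaSys_eq_N hupF hcapF hneF hk
    rw [hΛ, N_eq_neg_Z] at h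
    linarith
  have hcardu : (univ : Finset (Fin (n + 2))).card = n + 2 := by rw [Finset.card_univ, Fintype.card_fin]
  -- Step 1 (COATOM LEMMA): every co-point is good; hence disjoint point cores covering `c`, and `c ∖ κ_j ∈ F_l` for `l ≠ j`
  have hco : ∀ j : Fin (n + 2), univ.erase j ∈ Q := fun j => by
    rw [← sdiff_singleton_eq_erase]
    exact sdiff_singleton_mem_of_Z_eq_zero hQu hQX huQ (by omega) hZ (mem_univ j)
  have hst := fun j => core_erase_of_good hupF hcapF (hco j)
  have hdis : ∀ l j, l ≠ j → Disjoint (core F c {l}) (core F c {j}) := fun l j hlj => (hst j).2.2 l hlj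
  have hcov : ∀ x ∈ c, ∃ j, x ∈ core F c {j} := fun x hx => exists_mem_core hupF hcapF hk hx
  -- Step 2 (RESTRICTION LEMMA): `Z_Q(M) = 0`, `M = [n+2] ∖ i`; `M ∈ Q`
  set M : Finset (Fin (n + 2)) := univ \ {i} with hMdef
  have hZM : Z Q (fun _ => 1) M = 0 :=
    Z_sdiff_singleton_eq_zero (b := fun _ => 1) (fun _ => le_rfl) (mem_univ i) _ Q rfl hQX hQu huQ hi hZ
  have hMQ : M ∈ Q := by rw [hMdef, sdiff_singleton_eq_erase]; exact hco i
  have hcardM : M.card = n + 1 := by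
    have h1 : M.card = (univ : Finset (Fin (n + 2))).card - ({i} : Finset (Fin (n + 2))).card :=
      card_sdiff_of_subset (subset_univ _)
    rw [hcardu, card_singleton] at h1
    omega
  -- Step 3: `n ≥ 1` (for `n = 0`, `M` is a good singleton and `Z_Q(M) = −1`)
  have hn : 1 ≤ n := by
    by_contra hn
    obtain ⟨m, hm⟩ := card_eq_one.1 (show M.card = 1 by omega)
    rw [hm, Z_singleton, if_pos (hm ▸ hMQ)] at hZM
    exact (bw_pos (fun _ : Fin (n + 2) => 1) {m}).ne' (neg_eq_zero.1 hZM)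
  -- Step 4 (COATOM LEMMA on `Q|M`): the co-2-sets `M ∖ m` are good
  set QM := Q.filter fun R => R ⊆ M with hQMdef
  have hQMu : ∀ A ∈ QM, ∀ B ∈ QM, A ∪ B ∈ QM := by
    intro A hA B hB
    rw [hQMdef, mem_filter] at hA hB ⊢
    exact ⟨hQu A hA.1 B hB.1, union_subset hA.2 hB.2⟩
  have hQMX : QM ⊆ M.powerset := fun R hR => mem_powerset.2 (mem_filter.1 hR).2
  have hMQM : M ∈ QM := mem_filter.2 ⟨hMQ, subset_rfl⟩
  have hZQM : Z QM (fun _ => 1) M = 0 := by rw [hQMdef, ← Z_restrict]; exact hZM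
  have hco2 : ∀ m ∈ M, M \ {m} ∈ Q := fun m hm =>
    (mem_filter.1 (sdiff_singleton_mem_of_Z_eq_zero hQMu hQMX hMQM (by omega) hZQM hm)).1
  -- the core of a good block avoiding `i` lies in `c' = c ∖ κ_i` and avoids the cores of all non-members
  set c' := c \ core F c {i} with hc'def
  have hcoreR : ∀ R ∈ Q, i ∉ R → core F c R ⊆ c' ∧ ∀ m, m ∉ R → Disjoint (core F c R) (core F c {m}) := by
    intro R hR hiR
    obtain ⟨hRne, -, hRdis⟩ := mem_goodBlocks.1 hR
    have hd : ∀ m, m ∉ R → Disjoint (core F c R) (core F c {m}) := by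
      intro m hm
      rw [core_eq_biUnion hupF R hRne, disjoint_biUnion_left]
      exact fun l hl => hRdis l hl m hm
    exact ⟨fun x hx => mem_sdiff.2 ⟨core_subset hx, fun hxi => disjoint_left.1 (hd i hiR) hx hxi⟩, hd⟩
  -- Step 5 (CLAIM A): `U_{−i}` is principal-cap at `c'`
  have hc'U : ∀ l, l ≠ i → c' ∈ U l := fun l hl =>
    (mem_filter.1 ((mem_FR.1 (hst i).2.1).2 l (mem_erase.2 ⟨hl, mem_univ l⟩))).1
  set U' : Fin (n + 1) → Finset (Finset ι) := fun j => U (i.succAbove j) with hU'def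
  have hpc' : IsPrincipalCap U' c' := by
    intro a
    constructor
    · intro ha x hx
      obtain ⟨hxc, hxi⟩ := mem_sdiff.1 hx
      have hb : ∃ b ∈ FR F c {i}, x ∉ b := by
        by_contra h
        push Not at h
        exact hxi (mem_core.2 ⟨hxc, h⟩)
      obtain ⟨b, hb, hxb⟩ := hb
      have hbU : b ∈ U i := (mem_filter.1 ((mem_FR.1 hb).2 i (mem_singleton_self i))).1
      have hall : ∀ l, a ∪ b ∈ U l := by
        intro l
        by_cases hl : l = i
        · rw [hl]; exact hU _ _ _ hbU subset_union_right
        · obtain ⟨j', rfl⟩ := Fin.exists_succAbove_eq hl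
          exact hU _ _ _ (ha j') subset_union_left
      rcases mem_union.1 ((hpc _).1 hall hxc) with h | h
      · exact h
      · exact absurd h hxb
    · intro ha j'
      exact hU _ _ _ (hc'U _ (Fin.succAbove_ne i j')) ha
  -- Step 6: the traces `G` of `U_{−i}` on `2^{c'}`; their point cores sit inside the old ones
  set G := Fc U' c' with hGdef
  have hU'up : ∀ j a a', a ∈ U' j → a ⊆ a' → a' ∈ U' j := fun j => hU _
  have hU'0 : ∀ j, ∅ ∉ U' j := fun j => h0 _
  have hupG : ∀ j a a', a ∈ G j → a ⊆ a' → a' ⊆ c' → a' ∈ G j := Fc_upClosed hU'up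
  have hcapG : ∀ a : Finset ι, a ⊆ c' → ((∀ j, a ∈ G j) ↔ a = c') := Fc_cap_of_principalCap hpc'
  have hneG : ∀ j, ∅ ∉ G j := Fc_empty_notMem hU'0
  have hGmem : ∀ (j' : Fin (n + 1)) (a : Finset ι), a ∈ F (i.succAbove j') → a ⊆ c' → a ∈ G j' :=
    fun j' a ha hac' => mem_filter.2 ⟨(mem_filter.1 ha).1, hac'⟩
  have hFmem : ∀ (j' : Fin (n + 1)) (a : Finset ι), a ∈ G j' → a ∈ FR F c {i.succAbove j'} := by
    intro j' a ha
    have ha' := mem_filter.1 ha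
    refine mem_FR.2 ⟨ha'.2.trans sdiff_subset, fun l hl => ?_⟩
    rw [mem_singleton.1 hl]
    exact mem_filter.2 ⟨ha'.1, ha'.2.trans sdiff_subset⟩
  have hcoreG : ∀ j' : Fin (n + 1), core G c' {j'} ⊆ core F c {i.succAbove j'} := by
    intro j' x hx
    obtain ⟨hxc, hxi⟩ := mem_sdiff.1 (core_subset hx : x ∈ c')
    obtain ⟨j, hj⟩ := hcov x hxc
    by_cases hjl : j = i.succAbove j'
    · exact hjl ▸ hj
    · exfalso
      by_cases hji : j = i
      · exact hxi (hji ▸ hj)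
      · -- the co-2-set `M ∖ j` is good: its core is a trace member of slot `succAbove j'` inside `c'` avoiding `κ_j`
        have hjM : j ∈ M := mem_sdiff.2 ⟨mem_univ j, fun h => hji (mem_singleton.1 h)⟩
        have hR := hco2 j hjM
        have hiR : i ∉ M \ {j} := fun h => (mem_sdiff.1 (mem_sdiff.1 h).1).2 (mem_singleton_self i)
        have hlR : i.succAbove j' ∈ M \ {j} :=
          mem_sdiff.2 ⟨mem_sdiff.2 ⟨mem_univ _, fun h => Fin.succAbove_ne i j' (mem_singleton.1 h)⟩,
            fun h => hjl (mem_singleton.1 h).symm⟩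
        obtain ⟨hsub, hd⟩ := hcoreR _ hR hiR
        have hmemF : core F c (M \ {j}) ∈ F (i.succAbove j') := (mem_FR.1 (mem_goodBlocks.1 hR).2.1).2 _ hlR
        have hmemG : core F c (M \ {j}) ∈ FR G c' {j'} :=
          mem_FR.2 ⟨hsub, fun l hl => by rw [mem_singleton.1 hl]; exact hGmem j' _ hmemF hsub⟩
        have hxcore : x ∈ core F c (M \ {j}) := (mem_core.1 hx).2 _ hmemG
        exact disjoint_left.1 (hd j fun h => (mem_sdiff.1 h).2 (mem_singleton_self j)) hxcore hj
  -- Step 7: members of `Q` inside `M` pull back to good blocks of `G`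
  have hgood : ∀ R' : Finset (Fin (n + 1)), R'.image i.succAbove ∈ Q → R' ∈ goodBlocks G c' := by
    intro R' hR
    have hiR : i ∉ R'.image i.succAbove := fun h => by
      obtain ⟨j', -, hj'⟩ := mem_image.1 h
      exact Fin.succAbove_ne i j' hj'
    obtain ⟨hRne, hRmem, -⟩ := mem_goodBlocks.1 hR
    have hR'ne : R'.Nonempty := image_nonempty.1 hRne
    obtain ⟨hsub, -⟩ := hcoreR _ hR hiR
    have hmem : core F c (R'.image i.succAbove) ∈ FR G c' R' :=
      mem_FR.2 ⟨hsub, fun j' hj' => hGmem j' _ ((mem_FR.1 hRmem).2 _ (mem_image_of_mem _ hj')) hsub⟩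
    have hcoreEq : core G c' R' = core F c (R'.image i.succAbove) := by
      refine subset_antisymm (core_subset_of_mem hmem) fun x hx => mem_core.2 ⟨hsub hx, fun b hb => ?_⟩
      rw [core_eq_biUnion hupF _ hRne, mem_biUnion] at hx
      obtain ⟨l, hl, hxl⟩ := hx
      obtain ⟨j', hj', rfl⟩ := mem_image.1 hl
      exact core_subset_of_mem (hFmem j' b ((mem_FR.1 hb).2 j' hj')) hxl
    refine mem_goodBlocks.2 ⟨hR'ne, hcoreEq ▸ hmem, fun l' hl' m' hm' => ?_⟩
    have hne : i.succAbove l' ≠ i.succAbove m' := fun h => hm' (Fin.succAbove_right_injective h ▸ hl')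
    exact (hdis _ _ hne).mono (hcoreG l') (hcoreG m')
  -- Step 8: the pulled-back family `Qh` (union-closed, contains `univ`, inside `goodBlocks G`)
  set Qh : Finset (Finset (Fin (n + 1))) := univ.filter fun R' => R'.image i.succAbove ∈ Q with hQhdef
  have hQh_mem : ∀ R', R' ∈ Qh ↔ R'.image i.succAbove ∈ Q := fun R' => by simp [hQhdef]
  have hQh_sub : Qh ⊆ goodBlocks G c' := fun R' hR' => hgood R' ((hQh_mem R').1 hR')
  have hQh_u : ∀ A ∈ Qh, ∀ B ∈ Qh, A ∪ B ∈ Qh := by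
    intro A hA B hB
    rw [hQh_mem] at hA hB ⊢
    rw [image_union]
    exact hQu _ hA _ hB
  have himage_univ : (univ : Finset (Fin (n + 1))).image i.succAbove = M := by
    ext l
    simp only [mem_image, mem_univ, true_and, hMdef, mem_sdiff, mem_singleton]
    exact Fin.exists_succAbove_eq_iff
  have hQh_univ : (univ : Finset (Fin (n + 1))) ∈ Qh := by rw [hQh_mem, himage_univ]; exact hMQ
  -- Step 9 (RELABELLING): `Z_{Qh}(univ) = Z_{Q|M}(M) = 0`
  have hZQh : Z Qh (fun _ => 1) univ = 0 := by
    rw [← Z_image_of_injective (Fin.succAbove_right_injective : Injective i.succAbove) Qh _ univ rfl, himage_univ]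
    have hfam : Qh.image (Finset.image i.succAbove) = QM := by
      ext A
      rw [mem_image, hQMdef, mem_filter]
      constructor
      · rintro ⟨R', hR', rfl⟩
        exact ⟨(hQh_mem R').1 hR', by rw [← himage_univ]; exact image_subset_image (subset_univ _)⟩
      · rintro ⟨hAQ, hAM⟩
        rw [← himage_univ] at hAM
        obtain ⟨R', -, hR'⟩ := subset_image_iff.1 hAM
        exact ⟨R', (hQh_mem R').2 (hR'.symm ▸ hAQ), hR'⟩
    rw [hfam]
    exact hZQM
  -- Step 10 (ANTITONICITY): `0 ≤ −Z_{goodBlocks G} ≤ −Z_{Qh} = 0`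
  have hgbX : goodBlocks G c' ⊆ (univ : Finset (Fin (n + 1))).powerset := fun R _ => mem_powerset.2 (subset_univ R)
  have hgbne : ∀ R ∈ goodBlocks G c', R.Nonempty := fun R hR => (mem_goodBlocks.1 hR).1
  have hgbu : ∀ A ∈ goodBlocks G c', ∀ B ∈ goodBlocks G c', A ∪ B ∈ goodBlocks G c' :=
    fun A hA B hB => goodBlocks_union hupG hA hB
  have hle : Z Qh (fun _ => 1) univ ≤ Z (goodBlocks G c') (fun _ => 1) univ :=
    Z_mono_family (fun _ => le_rfl) _ Qh (goodBlocks G c') rfl hQh_sub hgbX hgbne hQh_u hgbu hQh_univ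
  have hk' : 0 < n + 1 := by omega
  have hN' := LambdaSys_eq_N hupG hcapG hneG hk'
  have hnn := LambdaSys_nonneg hupG hcapG hneG hk'
  refine ⟨c', hpc', ?_⟩
  rw [hN', N_eq_neg_Z] at hnn ⊢
  rw [hZQh] at hle
  linarith

end Events

/-! ### The key step and the principal-cap dichotomy at every order -/

/-- **`KeyStep n` holds for every `n`** (PROOF-PCD.md §2–§4): a principal-cap family of `n + 2` increasing events with `Λ = 0` is
either a family of pairwise disjoint cylinders (identically zero) or loses nothing by deleting a slot whose singleton block is not
good. [this work] -/
theorem keyStep_holds (n : ℕ) : KeyStep.{u} n := by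
  intro ι _ _ U c hU h0 hpc hΛ
  by_cases hall : ∀ j, ({j} : Finset (Fin (n + 2))) ∈ goodBlocks (Fc U c) c
  · exact Or.inl (sahiE_eq_zero_of_forall_singleton_good hU hpc hall)
  · push Not at hall
    obtain ⟨i, hi⟩ := hall
    exact Or.inr ⟨i, exists_principalCap_delete hU h0 hpc hΛ i hi⟩

/-- **THE PRINCIPAL-CAP DICHOTOMY AT EVERY ORDER (`PCD n` for all `n`).**  For every principal-cap family of `n + 1` increasing events
(`⋂ U_i = ↑c`, up-closed, `∅ ∉ U_i`) with `Λ(U) = N_{Q(c)}(𝟙) = 0`, Sahi's functional `E_{n+1}(spw w p; 1_U)` vanishes for all `w`, `p`.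
With `lambdaSys_eq_zero_of_forall_sahiE_eq_zero` (converse) and `exists_pos_forall_sahiE_spw_pos_of_principalCap` (`Λ > 0 ⇒ E > 0`
near `p = 0`): on the principal-cap class the identically-zero locus of the master family is the finite criterion `N_{Q(c)}(𝟙) = 0`.
[this work] -/
theorem pcd_holds (n : ℕ) : PCD.{u} n := pcd_of_keyStep keyStep_holds n

/-- **The dichotomy, `iff` form** (principal-cap families, unit intensities): `E ≡ 0 ⟺ Λ(U) = 0`. [this work] -/
theorem forall_sahiE_eq_zero_iff_lambdaSys_eq_zero {ι : Type u} [Fintype ι] [DecidableEq ι] {n : ℕ}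
    (U : Fin (n + 1) → Finset (Finset ι)) (c : Finset ι) (hU : ∀ i a a', a ∈ U i → a ⊆ a' → a' ∈ U i) (h0 : ∀ i, ∅ ∉ U i)
    (hpc : IsPrincipalCap U c) :
    (∀ (w : ι → ℝ) (p : ℝ), sahiE (spw w p) (n + 1) (fun i => setInd (U i)) = 0) ↔ LambdaSys (Fc U c) c = 0 :=
  ⟨fun h => lambdaSys_eq_zero_of_forall_sahiE_eq_zero U hU h0 hpc (h _), fun h w p => pcd_holds n ι U c hU h0 hpc h w p⟩

end SahiSparseEnd

end Summit.CriticalPhenomena.PercolationContinuityZ3.Theorems
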